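import Summits.ResolutionOfSingularities.ResolutionOfSingularities.Theorems.EquisingularLiftEquisingularLiftNatUncentredConeGerm
import Summits.ResolutionOfSingularities.ResolutionOfSingularities.Theorems.EquisingularLiftEquisingularLiftNatCarrierDeltaFrameAdapted
import Summits.ResolutionOfSingularities.ResolutionOfSingularities.Theorems.EquisingularLiftEquisingularLiftNatConeShadowLocal
import Summits.ResolutionOfSingularities.ResolutionOfSingularities.Theorems.EquisingularLiftEquisingularLiftNatConeFormConstants
import Summits.ResolutionOfSingularities.ResolutionOfSingularities.Theorems.EquisingularLiftEquisingularLiftNatTowerConeDefs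
import Summits.ResolutionOfSingularities.ResolutionOfSingularities.Theorems.EquisingularLiftEquisingularLiftNatTCPlusPlusInvBasePrep
import Literature.AlgebraicGeometry.Resolution.EtaleVanishingIdeal
import Mathlib.Algebra.CharP.Algebra
import HarnessLib

/-!
# [OURS · L1 W4.5(b) · EL♮(3)] S7 — THE CONE GERM OF THE UNCENTRED MEMBER IN THE `ConeForm` FRAME, with the localized shadow trace (vii-loc)
# (crux `EquisingularLiftNatThree` = stmt-ResolutionOfSingularities-20148; consumer: `tcPlus_memberKCL_uncentred`, …NatTCPlusMemberKCLUncentred)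

res-type-100 g12, object S7 `hBaseKCL` (res-D-pv-029 TOWER₃ assembly, res-L1-w45b-plan-1 CHAIN v7.31 §1(1); res-D-pv-029 DECISION
2026-08-27T20:53:20Z: repair (R1), currency `TCPlus.MemberKCL`/`InvKCL`, …NatSubchainSupplierInvKDefs v3 p570160). OURS; NOT a statement of any
manuscript; AI-written, weaker than expert review; `--supports stmt-ResolutionOfSingularities-20148 --as helper`; closes nothing. Definition-free.

WHY A RE-RUN (res-type-100 FINDING-2, STATUS 2026-08-27T21:05:50Z): the cone-form exactness `(K₀·𝒪_{F₁})_x = 𝓘⟨closure W⟩_x` of the Member's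
cone holds only in section frames whose special-fibre image is k-AFFINELY related to the `ConeForm` frame (witness: `W = V(c₁c₂)` is a cone in
`(c₁,c₂,c₃)` but `(c̄₁(c̄₂ + c̄₃²))` is generated by no constant-coefficient form in `(c₁, c₂ − c₃², c₃)`), and `exists_coneGerm_of_admTC`
(…NatUncentredConeGerm) chooses its frame internally. Here (S1′) the frame is res-D-pv-051's LIFT of the `ConeForm` frame
(`exists_sectionFrame_lift_model`, …NatTCPlusPlusInvBasePrep), (S2′) the local equation is the cone form `φ` of `W` itself, (S3)–(S5) are verbatim,
and the germ identity follows from …NatConeFormConstants (`span_eval_map_eq_of_reduction`: in characteristic `p` the root-divisible coefficients of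
`φ` are constants, and every `O`-lift of the square-free reduction is EXACT), whence (vii-loc) by …NatConeShadowLocal.

* `ringKrullDim_stalk_succ_eq_of_model` — `dim 𝒪_{F₁,x} + 1 = dim 𝒪_{X',j x}` in a model square with a section frame (`𝒪_{F₁,x} ≅ 𝒪_{X',j x}/(ϖ)`).
* `exists_coneGerm_of_admTC_coneForm` — `exists_coneGerm_of_admTC` under `ConeForm F₁ x W` (instead of the principal affine open; `x ∈ W` not
  needed), `[CharP k p]`, with the extra clause (vii-loc) `∃ V ⊇ υ⁻¹{x}` open, `((St_{τ₁} K₀)·𝒪_{F₂})|_V = 𝓘⟨closure υ⁻¹(W ∖ {x})⟩|_V` for EVERY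
  cone ideal `K₀` with the prescribed germ.
(The member `TCPlus.MemberKCL … ∅` itself is assembled in …NatTCPlusMemberKCLUncentred.)

References: H. Matsumura, *Commutative Ring Theory* (1986), Thm. 14.2, Thm. 8.10; The Stacks Project, Tags 0804, 080E, 00KW; U. Görtz,
T. Wedhorn, *Algebraic Geometry I* (2020), Prop. 13.91, 13.96 — through the cited tree files.
-/

set_option linter.dupNamespace false -- mandated namespace `Summit.<Summit>.<Problem>` of this single-conjunct summit
set_option linter.overlappingInstances false -- the binders carry `[IsDomain O] [IsDiscreteValuationRing O]`

noncomputable section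

open CategoryTheory CategoryTheory.Limits AlgebraicGeometry TopologicalSpace IsLocalRing
open Literature.AlgebraicGeometry.Resolution
open AlgebraicGeometry.Scheme.IdealSheafData
open Summit.ResolutionOfSingularities.ResolutionOfSingularities.Cruxes.EquisingularLift.StrataSplit

namespace Summit.ResolutionOfSingularities.ResolutionOfSingularities.Cruxes.EquisingularLiftNat.Sections

/-! ## The dimension of the special stalk -/

/-- **`dim 𝒪_{F₁,x} + 1 = dim 𝒪_{X',j x}`.** In a model square over a DVR with uniformizer `ϖ`, with `(c) + (ϖ) = 𝔪_{j x}` and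
`ϖ ∉ (c)`: `𝒪_{F₁,x} ≅ 𝒪_{X',j x}/(ϖ)` (`j^♯_x` onto with kernel `(ϖ)`) and `ϖ ≠ 0` is a non-zero-divisor in `𝔪`.
[cite: StacksProject, Tag 00KW] [folklore] -/
theorem ringKrullDim_stalk_succ_eq_of_model (O : Type) [CommRing O] [IsDomain O] [IsDiscreteValuationRing O] (k : Type) [Field k]
    (θ : O →+* k) (hθ : Function.Surjective θ) {X' F₁ : Scheme.{0}} [IsIntegral X'] [IsLocallyNoetherian X']
    (r' : X' ⟶ Spec (.of O)) (j : F₁ ⟶ X') (t : F₁ ⟶ Spec (.of k)) (hsq : IsPullback j t r' (Spec.map (CommRingCat.ofHom θ)))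
    (x : F₁) (ϖ : O) (hϖ : Irreducible ϖ) {n : ℕ} (c : Fin n → X'.presheaf.stalk (j x))
    (h𝔪 : Ideal.span (Set.range c) ⊔
      Ideal.span {(X'.presheaf.Γgerm (j x)).hom (r'.appTop.hom ((Scheme.ΓSpecIso (.of O)).inv.hom ϖ))} =
        maximalIdeal (X'.presheaf.stalk (j x)))
    (hϖc : (X'.presheaf.Γgerm (j x)).hom (r'.appTop.hom ((Scheme.ΓSpecIso (.of O)).inv.hom ϖ)) ∉ Ideal.span (Set.range c)) :
    ringKrullDim (F₁.presheaf.stalk x) + 1 = ringKrullDim (X'.presheaf.stalk (j x)) := by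
  have hϖO : ϖ ∈ maximalIdeal O := by rw [hϖ.maximalIdeal_eq]; exact Ideal.mem_span_singleton_self ϖ
  have hϖ𝔪 : (X'.presheaf.Γgerm (j x)).hom (r'.appTop.hom ((Scheme.ΓSpecIso (.of O)).inv.hom ϖ)) ∈
      maximalIdeal (X'.presheaf.stalk (j x)) := by
    rw [← h𝔪]; exact Ideal.mem_sup_right (Ideal.mem_span_singleton_self _)
  have hϖ0 : (X'.presheaf.Γgerm (j x)).hom (r'.appTop.hom ((Scheme.ΓSpecIso (.of O)).inv.hom ϖ)) ≠ 0 := by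
    intro h
    rw [h] at hϖc
    exact hϖc (Ideal.zero_mem _)
  have hker : RingHom.ker (j.stalkMap x).hom =
      Ideal.span {(X'.presheaf.Γgerm (j x)).hom (r'.appTop.hom ((Scheme.ΓSpecIso (.of O)).inv.hom ϖ))} :=
    le_antisymm (ker_stalkMap_model_le O k θ hθ r' j t hsq x ϖ hϖ)
      ((Ideal.span_singleton_le_iff_mem _).mpr (by
        rw [RingHom.mem_ker]; exact stalkMap_model_varpi θ hθ r' j t hsq x ϖ hϖO))
  rw [← ringKrullDim_eq_of_ringEquiv ((Ideal.quotEquivOfEq hker.symm).trans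
    (RingHom.quotientKerEquivOfSurjective (stalkMap_model_surjective θ hθ r' j t hsq x)))]
  exact ringKrullDim_quotient_span_singleton_succ_eq_ringKrullDim_of_mem_nonZeroDivisors (mem_nonZeroDivisors_of_ne_zero hϖ0) hϖ𝔪

/-! ## The cone germ of the uncentred member, `ConeForm` frame -/

section Uncentred

/-- **THE CONE GERM OF THE UNCENTRED MEMBER IN THE `ConeForm` FRAME (any `n`), with the localized shadow trace.** As
`exists_coneGerm_of_admTC` (…NatUncentredConeGerm), with `ConeForm F₁ x W` in place of the principal affine open and `k` of prime
characteristic `p`: the carrier `E = (ker s)·𝒪_{X₁}` is regular with principal stalks, and there is a non-zero germ `f ∈ 𝒪_{X',j x}` — the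
`O`-cone `Φ₀(c)` of a Δ-regular lift of the square-free reduced tangent cone, over the section frame LIFTING the cone-form frame — such that for
EVERY ideal sheaf `K₀` with `K₀_{j x} = (f)` the pair `(E, St_{τ₁} K₀)` has clauses (i)–(v), a regular `V(E ⊔ St K₀)`, AND (vii-loc): on an open
`V ⊇ υ⁻¹{x}` of `F₂`, `(St_{τ₁} K₀)·𝒪_{F₂} = 𝓘⟨closure υ⁻¹(W ∖ {x})⟩` (the germ identity `(K₀·𝒪_{F₁})_x = 𝓘⟨closure W⟩_x` by
…NatConeFormConstants, then …NatConeShadowLocal). [cite: Matsumura1987, Thm. 14.2; StacksProject, Tag 0804] [OURS · L1 W4.5b] S7; NOT a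
statement of the manuscript. -/
theorem exists_coneGerm_of_admTC_coneForm (p : ℕ) [Fact p.Prime] (k : Type) [Field k] [CharP k p] [IsAlgClosed k] (n : ℕ) :
    ∀ (O : Type) [CommRing O] [IsDomain O] [IsDiscreteValuationRing O] [IsAdicComplete (IsLocalRing.maximalIdeal O) O]
    [IsAlgClosed (IsLocalRing.ResidueField O)] (θ : O →+* k), Function.Surjective θ →
    ∀ (X' : AlgebraicGeometry.Scheme.{0}) (r' : X' ⟶ AlgebraicGeometry.Spec (.of O)) [AlgebraicGeometry.IsIntegral X']
    [IsLocallyNoetherian X'], Literature.AlgebraicGeometry.Resolution.Scheme.IsRegular X' → AlgebraicGeometry.IsProper r' →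
    ∀ (U : X'.Opens), AlgebraicGeometry.Smooth (U.ι ≫ r') →
    ∀ (s : AlgebraicGeometry.Spec (.of O) ⟶ X'), s ≫ r' = 𝟙 _ → s (IsLocalRing.closedPoint O) ∈ U →
    ringKrullDim (X'.presheaf.stalk (s (IsLocalRing.closedPoint O))) = ((n + 1 : ℕ) : WithBot ℕ∞) →
    ∀ (X₁ : AlgebraicGeometry.Scheme.{0}) (τ₁ : X₁ ⟶ X'), Literature.AlgebraicGeometry.Resolution.IsBlowup τ₁ s.ker →
    ∀ (F₁ : AlgebraicGeometry.Scheme.{0}) [AlgebraicGeometry.IsIntegral F₁] (j : F₁ ⟶ X')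
    (t : F₁ ⟶ AlgebraicGeometry.Spec (.of k)),
    IsPullback j t r' (AlgebraicGeometry.Spec.map (CommRingCat.ofHom θ)) →
    ∀ (x : F₁) (hx : IsClosed ({x} : Set F₁)), s (IsLocalRing.closedPoint O) = j x →
    ∀ (F₂ : AlgebraicGeometry.Scheme.{0}) [AlgebraicGeometry.IsIntegral F₂] (υ : F₂ ⟶ F₁),
    Literature.AlgebraicGeometry.Resolution.IsBlowup υ
    (AlgebraicGeometry.Scheme.IdealSheafData.vanishingIdeal (⟨{x}, hx⟩ : TopologicalSpace.Closeds F₁)) →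
    ∀ (j₂ : F₂ ⟶ X₁) (t₂ : F₂ ⟶ AlgebraicGeometry.Spec (.of k)),
    IsPullback j₂ t₂ (τ₁ ≫ r') (AlgebraicGeometry.Spec.map (CommRingCat.ofHom θ)) → j₂ ≫ τ₁ = υ ≫ j →
    (s.ker.comap τ₁).comap j₂ =
    (AlgebraicGeometry.Scheme.IdealSheafData.vanishingIdeal (⟨{x}, hx⟩ : TopologicalSpace.Closeds F₁)).comap υ →
    ∀ (W : Set F₁) (hZ : IsClosed (υ ⁻¹' {x} ∩ closure (υ ⁻¹' (W \ {x})))),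
    ¬ (υ ⁻¹' {x} ⊆ closure (υ ⁻¹' (W \ {x}))) →
    ConeForm F₁ x W →
    -- finitely many non-regular points of the reduced trace — OR the plane case `n = 3`, where this is automatic
    (n = 3 ∨ Set.Finite {z : ↥(AlgebraicGeometry.Scheme.IdealSheafData.vanishingIdeal
    (⟨υ ⁻¹' {x} ∩ closure (υ ⁻¹' (W \ {x})), hZ⟩ : TopologicalSpace.Closeds F₂)).subscheme |
    ¬ IsRegularLocalRing ((AlgebraicGeometry.Scheme.IdealSheafData.vanishingIdeal
    (⟨υ ⁻¹' {x} ∩ closure (υ ⁻¹' (W \ {x})), hZ⟩ : TopologicalSpace.Closeds F₂)).subscheme.presheaf.stalk z)}) →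
    Literature.AlgebraicGeometry.Resolution.Scheme.IsRegular (s.ker.comap τ₁).subscheme ∧
    (∀ z : X₁, (stalkIdeal (s.ker.comap τ₁) z).IsPrincipal) ∧
    ∃ f : X'.presheaf.stalk (j x), f ≠ 0 ∧ ∀ (K₀ : X'.IdealSheafData), stalkIdeal K₀ (j x) = Ideal.span {f} →
    -- (i) exact special fibre
    (s.ker.comap τ₁ ⊔ strictTransformIdeal τ₁ s.ker K₀).comap j₂ = AlgebraicGeometry.Scheme.IdealSheafData.vanishingIdeal
      (⟨υ ⁻¹' {x} ∩ closure (υ ⁻¹' (W \ {x})), hZ⟩ : TopologicalSpace.Closeds F₂) ∧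
    -- (ii) flat over `O`
    AlgebraicGeometry.Flat ((s.ker.comap τ₁ ⊔ strictTransformIdeal τ₁ s.ker K₀).subschemeι ≫ τ₁ ≫ r') ∧
    -- (iii′) the cone is principal at the special points of the pair
    (∀ z ∈ ((s.ker.comap τ₁ ⊔ strictTransformIdeal τ₁ s.ker K₀).support : Set X₁), (τ₁ ≫ r') z = IsLocalRing.closedPoint O →
      (stalkIdeal (strictTransformIdeal τ₁ s.ker K₀) z).IsPrincipal) ∧
    -- (iv) inside the carrier
    ((s.ker.comap τ₁ ⊔ strictTransformIdeal τ₁ s.ker K₀).support : Set X₁) ⊆ ((s.ker.comap τ₁).support : Set X₁) ∧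
    -- (v) regular quotient stalks at every point of the pair, of codimension `2` over the closed point; the pair is regular
    (∀ z ∈ ((s.ker.comap τ₁ ⊔ strictTransformIdeal τ₁ s.ker K₀).support : Set X₁),
      IsRegularLocalRing (X₁.presheaf.stalk z ⧸ stalkIdeal (s.ker.comap τ₁ ⊔ strictTransformIdeal τ₁ s.ker K₀) z)) ∧
    (∀ z ∈ ((s.ker.comap τ₁ ⊔ strictTransformIdeal τ₁ s.ker K₀).support : Set X₁), (τ₁ ≫ r') z = IsLocalRing.closedPoint O →
      ringKrullDim (X₁.presheaf.stalk z ⧸ stalkIdeal (s.ker.comap τ₁ ⊔ strictTransformIdeal τ₁ s.ker K₀) z) + 2 =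
        ringKrullDim (X₁.presheaf.stalk z)) ∧
    Literature.AlgebraicGeometry.Resolution.Scheme.IsRegular (s.ker.comap τ₁ ⊔ strictTransformIdeal τ₁ s.ker K₀).subscheme ∧
    -- (vii-loc) the special fibre of the cone is the strict transform `St_x W` NEAR `υ⁻¹{x}` (res-D-pv-029 DECISION 2026-08-27T20:53:20Z)
    (∃ V : F₂.Opens, (υ ⁻¹' {x} : Set F₂) ⊆ (V : Set F₂) ∧
      ((strictTransformIdeal τ₁ s.ker K₀).comap j₂).comap V.ι = (AlgebraicGeometry.Scheme.IdealSheafData.vanishingIdeal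
        (⟨closure (υ ⁻¹' (W \ {x})), isClosed_closure⟩ : TopologicalSpace.Closeds F₂)).comap V.ι) := by
  intro O _ _ _ _ _ θ hθ X' r' _ _ hregX hproper U hU s hs hsU hdim4 X₁ τ₁ hτ₁ F₁ _ j t hsq x hx hss F₂ _ υ hυ j₂ t₂ hsq₂
    hcomm hE W hZ hnot hcone hfin
  classical
  -- adapted from res-type-100's `exists_coneGerm_of_admTC` (…NatUncentredConeGerm): (S1′) takes the section frame LIFTING the `ConeForm`
  -- frame (res-D-pv-051's `exists_sectionFrame_lift_model`), (S2′) takes the cone form of `W` ITSELF, (S3)–(S5) verbatim, plus (vii-loc)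
  haveI := hproper
  haveI : IsClosedImmersion (Spec.map (CommRingCat.ofHom θ)) := IsClosedImmersion.spec_of_surjective _ hθ
  haveI : IsClosedImmersion j := MorphismProperty.IsStableUnderBaseChange.of_isPullback hsq.flip inferInstance
  haveI : IsLocallyNoetherian X₁ := by
    haveI : IsProper τ₁ := hτ₁.isProper
    exact LocallyOfFiniteType.isLocallyNoetherian τ₁
  haveI : IsLocallyNoetherian F₁ := LocallyOfFiniteType.isLocallyNoetherian j
  haveI : IsLocallyNoetherian F₂ := by
    haveI : IsProper υ := hυ.isProper
    exact LocallyOfFiniteType.isLocallyNoetherian υ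
  obtain ⟨ϖ, hϖ⟩ := IsDiscreteValuationRing.exists_irreducible O
  have hϖO : ϖ ∈ maximalIdeal O := by rw [hϖ.maximalIdeal_eq]; exact Ideal.mem_span_singleton_self ϖ
  -- (S1′) SOME section frame at `p = j x` (only to read `dim 𝒪_{F₁,x} = n`), then THE section frame lifting the `ConeForm` frame
  rw [hss] at hdim4
  obtain ⟨n', c₀, -, -, -, -, -, h𝔪₀, hϖc₀, hdimn⟩ :=
    exists_sectionFrame_forall_dim_at O r' s hs (j x) hss (hregX (j x)) ϖ hϖ
  have hn : n' + 1 = n + 1 := by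
    have h := hdimn.symm.trans hdim4
    exact_mod_cast h
  obtain rfl : n = n' := by omega
  have hdimF := ringKrullDim_stalk_succ_eq_of_model O k θ hθ r' j t hsq x ϖ hϖ c₀ h𝔪₀ hϖc₀
  obtain ⟨m, d, cφ, φ, hspan, hdimm, -, hφd, hroot, hW⟩ := hcone
  have hmn : m + 1 = n + 1 := by
    rw [hdimm, hdim4] at hdimF
    exact_mod_cast hdimF
  obtain rfl : n = m := by omega
  obtain ⟨c, hcI, hcφ⟩ := exists_sectionFrame_lift_model O k θ hθ r' s hs j t hsq x hss (hregX (j x)) ϖ hϖ cφ hspan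
  obtain rfl : cφ = fun i => (j.stalkMap x).hom (c i) := funext fun i => (hcφ i).symm
  obtain ⟨θR, hqr, hdom, hθR, h𝔪, hϖc⟩ :=
    exists_sectionFrame_of_span_eq_forall_at O r' s hs (j x) hss (hregX (j x)) ϖ hϖ c hcI hdim4
  haveI := hdom
  -- the model frame downstairs (= the `ConeForm` frame)
  have hcb𝔪 : Ideal.span (Set.range fun i => (j.stalkMap x).hom (c i)) = maximalIdeal (F₁.presheaf.stalk x) := hspan
  have hcbar := isQuasiRegular_stalkMap_model O k θ hθ r' j t hsq x c hqr ϖ hϖ hϖc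
  haveI hFreg : IsRegularLocalRing (F₁.presheaf.stalk x) :=
    isRegularLocalRing_stalk_of_model O k θ hθ r' j t hsq x (hregX (j x)) ϖ hϖ c h𝔪 hϖc
  have hJ : s.ker.comap j = vanishingIdeal ⟨{x}, hx⟩ :=
    comap_ker_eq_vanishingIdeal_of_model θ hθ r' s hs j t hsq x hx hss c hcI hcb𝔪
  haveI hmax : (Ideal.span (Set.range fun i => (j.stalkMap x).hom (c i))).IsMaximal := by
    rw [hcb𝔪]; exact maximalIdeal.isMaximal _
  -- (S2′) the cone form `φ` of `W` ITSELF as the local equation (`φ̄ ≠ 0`: a root-divisible coefficient in `𝔪` vanishes, and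
  -- `𝓘⟨closure W⟩_x ≠ 0`), and its square-free reduction `G`
  have hkermk : RingHom.ker (Ideal.Quotient.mk (Ideal.span (Set.range fun i => (j.stalkMap x).hom (c i)))) =
      maximalIdeal (F₁.presheaf.stalk x) := Ideal.mk_ker.trans hcb𝔪
  have hΦ₁0 : MvPolynomial.map (Ideal.Quotient.mk (Ideal.span (Set.range fun i => (j.stalkMap x).hom (c i)))) φ ≠ 0 :=
    map_ne_zero_of_span_eval_ne_bot (Ideal.Quotient.mk _) hkermk _ φ hroot
      (by rw [← hW]; exact stalkIdeal_vanishingIdeal_closure_ne_bot hx hυ W hnot)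
  obtain ⟨d', G, hGd', hG0, hGsq, hR1, hR1', hR2, hR2sq⟩ :=
    exists_isHomogeneous_squarefree_reduction (fun i => (j.stalkMap x).hom (c i)) hmax φ hφd hΦ₁0
  -- (S3) the residue model `π₀ : O ↠ k₀ = 𝒪_{F₁,x}/(c̄)` and T-ΔLIFT over `k₀`
  letI : Field (F₁.presheaf.stalk x ⧸ Ideal.span (Set.range fun i => (j.stalkMap x).hom (c i))) :=
    Ideal.Quotient.field _
  obtain ⟨π₀, hπ₀def⟩ : ∃ π₀ : O →+* F₁.presheaf.stalk x ⧸ Ideal.span (Set.range fun i => (j.stalkMap x).hom (c i)),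
      π₀ = ((Ideal.Quotient.mk (Ideal.span (Set.range fun i => (j.stalkMap x).hom (c i)))).comp
        (j.stalkMap x).hom).comp ((Scheme.ΓSpecIso (.of O)).inv ≫ r'.appTop ≫ X'.presheaf.Γgerm (j x)).hom :=
    ⟨_, rfl⟩
  obtain ⟨hπ₀, hkerπ₀⟩ := residueModel_surjective_and_ker θ hθ r' j t hsq x c θR hθR hcb𝔪 hπ₀def
  haveI : Infinite (F₁.presheaf.stalk x ⧸ Ideal.span (Set.range fun i => (j.stalkMap x).hom (c i))) := by
    haveI : Infinite (ResidueField O) := inferInstance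
    exact Infinite.of_injective (β := ResidueField O)
      ((Ideal.quotEquivOfEq hkerπ₀.symm).trans (RingHom.quotientKerEquivOfSurjective hπ₀))
      ((Ideal.quotEquivOfEq hkerπ₀.symm).trans (RingHom.quotientKerEquivOfSurjective hπ₀)).injective
  have hρ₀ : (θR.toRingHom.comp (Ideal.Quotient.mk (Ideal.span (Set.range c)))).comp
      ((Scheme.ΓSpecIso (.of O)).inv ≫ r'.appTop ≫ X'.presheaf.Γgerm (j x)).hom = RingHom.id O :=
    RingHom.ext fun b => hθR b
  -- (S3′) the finiteness clause transported to the cone charts (res-L1-w45b-stub-2 T-PTPRIME-DICT)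
  have hZ' : IsClosed (υ ⁻¹' {x} ∩ closure (υ ⁻¹' (((⟨closure W, isClosed_closure⟩ : Closeds F₁) : Set F₁) \ {x}))) := by
    rw [Closeds.coe_mk, ← closure_preimage_diff_singleton_eq_of_isBlowup hx hυ W]; exact hZ
  have hcl : (⟨υ ⁻¹' {x} ∩ closure (υ ⁻¹' (W \ {x})), hZ⟩ : Closeds F₂) =
      ⟨υ ⁻¹' {x} ∩ closure (υ ⁻¹' (((⟨closure W, isClosed_closure⟩ : Closeds F₁) : Set F₁) \ {x})), hZ'⟩ :=
    Closeds.ext (by rw [Closeds.coe_mk, Closeds.coe_mk, Closeds.coe_mk, closure_preimage_diff_singleton_eq_of_isBlowup hx hυ W])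
  -- T-ΔLIFT: res-type-032's PLANE lemma at `n = 3` (finiteness from square-freeness), else the general one fed by stub-2's
  -- T-PTPRIME-DICT transport of the finiteness clause
  obtain ⟨Φ₀, hΦ₀d, hΦ₀g, h032⟩ : ∃ Φ₀ : MvPolynomial (Fin n) O, Φ₀.IsHomogeneous d' ∧ MvPolynomial.map π₀ Φ₀ =
      MvPolynomial.map (Ideal.Quotient.mk (Ideal.span (Set.range fun i => (j.stalkMap x).hom (c i)))) G ∧
      ∀ (i : Fin n) (Q : Ideal (MvPolynomial {l : Fin n // l ≠ i} O ⧸ Ideal.span {MvPolynomial.map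
        (θR.toRingHom.comp (Ideal.Quotient.mk (Ideal.span (Set.range c))))
        (dehomogenize i (MvPolynomial.map ((Scheme.ΓSpecIso (.of O)).inv ≫ r'.appTop ≫ X'.presheaf.Γgerm (j x)).hom Φ₀))}))
        [Q.IsPrime], Ideal.Quotient.mk _ (MvPolynomial.C ϖ : MvPolynomial {l : Fin n // l ≠ i} O) ∈ Q →
          IsRegularLocalRing (Localization.AtPrime Q) := by
    rcases hfin with hn3 | hfin
    · subst hn3
      have hgsq : ∀ i : Fin 3, Squarefree (dehomogenize i
          (MvPolynomial.map (Ideal.Quotient.mk (Ideal.span (Set.range fun i => (j.stalkMap x).hom (c i)))) G)) := fun i => by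
        have h := hR2sq i
        rwa [map_dehomogenize] at h
      exact exists_isHomogeneous_lift_deltaRegular_plane_comp hϖ π₀ hπ₀ hkerπ₀
        ((Scheme.ΓSpecIso (.of O)).inv ≫ r'.appTop ≫ X'.presheaf.Γgerm (j x)).hom
        (θR.toRingHom.comp (Ideal.Quotient.mk (Ideal.span (Set.range c)))) hρ₀
        (MvPolynomial.map (Ideal.Quotient.mk (Ideal.span (Set.range fun i => (j.stalkMap x).hom (c i)))) G)
        (hGd'.map _) hG0 hgsq
    · have hfin' := hfin
      rw [hcl] at hfin'
      have hfin032 : ∀ i : Fin n, {𝔮 : PrimeSpectrum (MvPolynomial {l : Fin n // l ≠ i}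
          (F₁.presheaf.stalk x ⧸ Ideal.span (Set.range fun i => (j.stalkMap x).hom (c i)))) |
          dehomogenize i (MvPolynomial.map (Ideal.Quotient.mk (Ideal.span (Set.range fun i => (j.stalkMap x).hom (c i)))) G) ∈
            𝔮.asIdeal ∧
          algebraMap _ (Localization.AtPrime 𝔮.asIdeal)
            (dehomogenize i (MvPolynomial.map (Ideal.Quotient.mk (Ideal.span (Set.range fun i => (j.stalkMap x).hom (c i)))) G)) ∈
            maximalIdeal (Localization.AtPrime 𝔮.asIdeal) ^ 2}.Finite := by
        intro i
        have hGj : MvPolynomial.map (Ideal.Quotient.mk (Ideal.span (Set.range fun i => (j.stalkMap x).hom (c i))))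
            (dehomogenize i G) ≠ 0 := fun h => by
          have hsq := hR2sq i
          rw [h] at hsq
          exact not_squarefree_zero hsq
        have h := finite_badPrimes_of_finite_nonregular_carrierTrace hx hυ (fun i => (j.stalkMap x).hom (c i)) hcb𝔪 hcbar
          (Ideal.Quotient.mk (Ideal.span (Set.range fun i => (j.stalkMap x).hom (c i)))) Ideal.Quotient.mk_surjective Ideal.mk_ker
          ⟨closure W, isClosed_closure⟩ φ G hφd hΦ₁0 hW hR1 hR1' hR2 hZ' hfin' i hGj
        rw [map_dehomogenize] at h
        exact h
      exact exists_isHomogeneous_lift_deltaRegular_comp hϖ π₀ hπ₀ hkerπ₀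
        ((Scheme.ΓSpecIso (.of O)).inv ≫ r'.appTop ≫ X'.presheaf.Γgerm (j x)).hom
        (θR.toRingHom.comp (Ideal.Quotient.mk (Ideal.span (Set.range c)))) hρ₀
        (MvPolynomial.map (Ideal.Quotient.mk (Ideal.span (Set.range fun i => (j.stalkMap x).hom (c i)))) G)
        (hGd'.map _) hfin032
  -- consequences: `Φ₀ ≢ 0 mod 𝔪_O`, `ι_* Φ₀ ≢ 0 mod (c)`, `j^♯ ι_* Φ₀ ≡ g mod (c̄)`
  have hΦ₀res : MvPolynomial.map (IsLocalRing.residue O) Φ₀ ≠ 0 := fun h => hG0 (by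
    rw [← hΦ₀g]
    refine map_eq_zero_of_coeff_mem_ker π₀ fun m => ?_
    rw [hkerπ₀, ← IsLocalRing.ker_residue]
    exact coeff_mem_ker_of_map_eq_zero (IsLocalRing.residue O) h m)
  have hΦ₀ne : Φ₀ ≠ 0 := fun h0 => hG0 (by rw [← hΦ₀g, h0, map_zero])
  have hΦι : MvPolynomial.map (Ideal.Quotient.mk (Ideal.span (Set.range c)))
      (MvPolynomial.map ((Scheme.ΓSpecIso (.of O)).inv ≫ r'.appTop ≫ X'.presheaf.Γgerm (j x)).hom Φ₀) ≠ 0 := by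
    intro h
    apply hΦ₀ne
    have h2 := congrArg (MvPolynomial.map θR.toRingHom) h
    rwa [MvPolynomial.map_map, MvPolynomial.map_map, hρ₀, MvPolynomial.map_id, map_zero] at h2
  have hΦbg : MvPolynomial.map (Ideal.Quotient.mk (Ideal.span (Set.range fun i => (j.stalkMap x).hom (c i))))
      (MvPolynomial.map (j.stalkMap x).hom
        (MvPolynomial.map ((Scheme.ΓSpecIso (.of O)).inv ≫ r'.appTop ≫ X'.presheaf.Γgerm (j x)).hom Φ₀)) =
      MvPolynomial.map (Ideal.Quotient.mk (Ideal.span (Set.range fun i => (j.stalkMap x).hom (c i)))) G := by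
    rw [MvPolynomial.map_map, MvPolynomial.map_map, ← hπ₀def, hΦ₀g]
  have hΦbar : MvPolynomial.map (Ideal.Quotient.mk (Ideal.span (Set.range fun i => (j.stalkMap x).hom (c i))))
      (MvPolynomial.map (j.stalkMap x).hom
        (MvPolynomial.map ((Scheme.ΓSpecIso (.of O)).inv ≫ r'.appTop ≫ X'.presheaf.Γgerm (j x)).hom Φ₀)) ≠ 0 := by
    rw [hΦbg]; exact hG0
  -- the Δ-criterion in the kit's `ρ`-form
  have hΔ : ∀ (ρ : X'.presheaf.stalk (j x) →+* O),
      ρ.comp ((Scheme.ΓSpecIso (.of O)).inv ≫ r'.appTop ≫ X'.presheaf.Γgerm (j x)).hom = RingHom.id O →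
      ∀ (i : Fin n) (Q : Ideal (MvPolynomial {l : Fin n // l ≠ i} O ⧸ Ideal.span {MvPolynomial.map ρ
        (dehomogenize i (MvPolynomial.map ((Scheme.ΓSpecIso (.of O)).inv ≫ r'.appTop ≫ X'.presheaf.Γgerm (j x)).hom Φ₀))}))
        [Q.IsPrime], Ideal.Quotient.mk _ (MvPolynomial.C ϖ : MvPolynomial {l : Fin n // l ≠ i} O) ∈ Q →
          IsRegularLocalRing (Localization.AtPrime Q) :=
    fun ρ hρ i => forall_ideal_quotient_span_singleton_congr
      ((map_dehomogenize_map_of_comp_eq_id _ ρ hρ i Φ₀).trans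
        (map_dehomogenize_map_of_comp_eq_id _ _ hρ₀ i Φ₀).symm) (MvPolynomial.C ϖ) (h032 i)
  have hΦιd : (MvPolynomial.map ((Scheme.ΓSpecIso (.of O)).inv ≫ r'.appTop ≫ X'.presheaf.Γgerm (j x)).hom Φ₀).IsHomogeneous d' :=
    hΦ₀d.map _
  have hpJ : j x ∈ (s.ker.support : Set X') := by
    obtain ⟨-, -, -, hsupp⟩ := section_isClosedImmersion_and_isRegular_ker O X' r' s hs
    rw [hsupp, ← hss]; exact Set.mem_range_self _
  haveI : IsRegularRing (X'.presheaf.stalk (j x) ⧸ Ideal.span (Set.range c)) := IsRegularRing.of_ringEquiv θR.symm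
  refine ⟨isRegular_exceptional_subscheme O r' s hs (j x) hss τ₁ hτ₁ c hcI hqr θR, fun z => ?_,
    MvPolynomial.eval c (MvPolynomial.map ((Scheme.ΓSpecIso (.of O)).inv ≫ r'.appTop ≫ X'.presheaf.Γgerm (j x)).hom Φ₀),
    eval_ne_zero_of_isQuasiRegular hqr hΦιd hΦι, fun K₀ hK => ?_⟩
  · -- `E` is locally principal (an effective Cartier divisor)
    obtain ⟨g, -, hg⟩ := hτ₁.isEffectiveCartier.exists_stalkIdeal_eq_span z
    exact ⟨⟨g, hg⟩⟩
  -- (S4) T-CARRIER-Δ for the arbitrary cone ideal `K₀` (part 1a); rewrite `E ⊔ St K₀ = St K₀ ⊔ E` once and for all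
  obtain ⟨hCreg, hCflat, hCsupp⟩ := carrierDelta_clauses_of_stalk O r' s hs (j x) hss (hregX (j x)) τ₁ hτ₁ ϖ hϖ c hcI hdim4
    Φ₀ hΦ₀d hΦ₀res hΔ K₀ hK
  rw [show s.ker.comap τ₁ ⊔ strictTransformIdeal τ₁ s.ker K₀ = strictTransformIdeal τ₁ s.ker K₀ ⊔ s.ker.comap τ₁ from sup_comm _ _]
  -- the germ identity downstairs: `(K₀·𝒪_{F₁})_x = ((j^♯ι)_*Φ₀(c̄)) = (φ(c̄)) = 𝓘⟨closure W⟩_x` (…NatConeFormConstants: every lift is exact)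
  have hK' : stalkIdeal (K₀.comap j) x =
      Ideal.span {MvPolynomial.eval (fun i => (j.stalkMap x).hom (c i)) (MvPolynomial.map (j.stalkMap x).hom
        (MvPolynomial.map ((Scheme.ΓSpecIso (.of O)).inv ≫ r'.appTop ≫ X'.presheaf.Γgerm (j x)).hom Φ₀))} := by
    rw [stalkIdeal_comap_eq_map_stalkMap, hK, Ideal.map_span, Set.image_singleton, ringHom_eval_eq_eval_map]
  haveI : CharP (F₁.presheaf.stalk x) p :=
    charP_of_injective_ringHom (((Scheme.ΓSpecIso (.of k)).inv ≫ t.appTop ≫ F₁.presheaf.Γgerm x).hom.injective) p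
  have hsurjρ : Function.Surjective ((Ideal.Quotient.mk (Ideal.span (Set.range fun i => (j.stalkMap x).hom (c i)))).comp
      ((j.stalkMap x).hom.comp ((Scheme.ΓSpecIso (.of O)).inv ≫ r'.appTop ≫ X'.presheaf.Γgerm (j x)).hom)) := by
    rw [← RingHom.comp_assoc, ← hπ₀def]; exact hπ₀
  have hkerρ : ∀ b : O, Ideal.Quotient.mk (Ideal.span (Set.range fun i => (j.stalkMap x).hom (c i)))
      (((j.stalkMap x).hom.comp ((Scheme.ΓSpecIso (.of O)).inv ≫ r'.appTop ≫ X'.presheaf.Γgerm (j x)).hom) b) = 0 →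
      ((j.stalkMap x).hom.comp ((Scheme.ΓSpecIso (.of O)).inv ≫ r'.appTop ≫ X'.presheaf.Γgerm (j x)).hom) b = 0 := by
    intro b hb
    have hb𝔪 : b ∈ maximalIdeal O := by
      rw [← hkerπ₀, RingHom.mem_ker, hπ₀def]; exact hb
    exact stalkMap_model_varpi θ hθ r' j t hsq x b hb𝔪
  have hexact : Ideal.span {MvPolynomial.eval (fun i => (j.stalkMap x).hom (c i)) (MvPolynomial.map (j.stalkMap x).hom
      (MvPolynomial.map ((Scheme.ΓSpecIso (.of O)).inv ≫ r'.appTop ≫ X'.presheaf.Γgerm (j x)).hom Φ₀))} =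
      Ideal.span {MvPolynomial.eval (fun i => (j.stalkMap x).hom (c i)) φ} := by
    rw [MvPolynomial.map_map]
    refine span_eval_map_eq_of_reduction _ (Ideal.Quotient.mk _) hkermk hsurjρ hkerρ p _ φ hroot
      (by rw [← hW]; exact isRadical_stalkIdeal_vanishingIdeal _ _) Φ₀ ?_ ?_
    · rw [← MvPolynomial.map_map, ← MvPolynomial.map_map, hΦbg]
      exact dvd_of_mem_radical_span_of_squarefree hGsq hR1
    · rw [← MvPolynomial.map_map, ← MvPolynomial.map_map, hΦbg]
      exact hR1'
  have hKW : stalkIdeal (K₀.comap j) x = stalkIdeal (vanishingIdeal (⟨closure W, isClosed_closure⟩ : Closeds F₁)) x := by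
    rw [hK', hexact, hW]
  refine ⟨?_, hCflat, ?_, hCsupp, fun z hz => isRegularLocalRing_quotient_stalkIdeal_of_isRegular_subscheme _ hCreg hz, ?_, hCreg,
    exists_nhd_comap_strictTransformIdeal_eq_vanishingIdeal_of_model τ₁ s.ker K₀ hτ₁ j υ j₂ hcomm x hx hυ hJ c hcI hqr _ hΦιd hΦι
      hK hcbar hΦbar W hKW⟩
  · -- (i) = (S5): the special fibre, (v) then T-TCONE (2) for `closure W`, then `closure W ↦ W` (verbatim from HΔTC)
    rw [comap_strictTransformIdeal_sup_comap_eq_of_model τ₁ s.ker _ hτ₁ j υ j₂ hcomm x hx hυ hJ c hcI hqr _ hΦιd hΦι hK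
      hcbar hΦbar]
    rw [hcl]
    exact (vanishingIdeal_carrierTrace_eq_strictTransformIdeal_sup_comap hx hυ (fun i => (j.stalkMap x).hom (c i)) hcb𝔪 hcbar
      ⟨closure W, isClosed_closure⟩ _ φ _ hφd (hΦιd.map _) hΦ₁0 hΦbar hW hK' (by rw [hΦbg]; exact hR1)
      (by rw [hΦbg]; exact hR1') (fun i => by rw [map_dehomogenize, hΦbg, ← map_dehomogenize]; exact hR2 i) hZ').symm
  · -- (iii′) the cone is principal at the special points of the pair (all over `p = j x`)
    intro z hz hzq
    have hzp : τ₁ z = j x := by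
      rw [← hss]
      exact support_carrierDelta_inter_preimage_closedPoint_subset O r' s hs τ₁ _ ⟨hz, hzq⟩
    exact isPrincipal_stalkIdeal_strictTransformIdeal_of_cone hτ₁ _ z (j x) hzp hpJ c hcI hqr _ hΦιd hΦι hK
  · -- (v) codimension `2` at the special points of the pair
    intro z hz hzq
    have hzp : τ₁ z = j x := by
      rw [← hss]
      exact support_carrierDelta_inter_preimage_closedPoint_subset O r' s hs τ₁ _ ⟨hz, hzq⟩
    exact ringKrullDim_quotient_carrierDelta_add_two hτ₁ _ z (j x) hzp hpJ c hcI hqr _ hΦιd hΦι hK hz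


end Uncentred

end Summit.ResolutionOfSingularities.ResolutionOfSingularities.Cruxes.EquisingularLiftNat.Sections

end
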